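import Mathlib
import HarnessLib
import Literature.Analysis.FluidPDE.Tao2016AveragedNS.LocalCascadeSolutions
import Literature.Analysis.FluidPDE.Tao2016AveragedNS.RenormalisedCascadeWaves
import Literature.Analysis.FluidPDE.Tao2016AveragedNS.SelfSimilarCascadeBlowup
import Literature.Analysis.FluidPDE.Tao2016AveragedNS.ViscousEternalSolutions
import Literature.Analysis.FluidPDE.Tao2016AveragedNS.BoundedEternalSolutions
import Summits.NavierStokesRegularity.NavierStokesRegularity.Theorems.TaoLadderRungTwoBreakEternalRigidityViscBddOneDefs
import Summits.NavierStokesRegularity.NavierStokesRegularity.Theorems.TaoLadderRungTwoBreakEternalRigidityViscBddOneLimitOfCeilings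
import Summits.NavierStokesRegularity.NavierStokesRegularity.Theorems.WakeRatchetMinimalViscousBlowupEveryShellFires
import Summits.NavierStokesRegularity.NavierStokesRegularity.Theorems.WakeRatchetMinimalViscousBlowupFiredClockAction

/-!
# Crux `TaoLadderRungTwoBreak.EternalRigidityViscBddOne` (stmt-NavierStokesRegularity-20420): the open stub (ω4)
# `stub_eternalLimitViscBdd` REDUCED TO ONE ESTIMATE — the a=1 ENERGY ENVELOPE of a type-I viscous blow-up

`…EternalRigidityViscBddOneLimitOfCeilings` (this hand) showed (ω4)'s conclusion from `ViscousUpTo` + `TypeOne` + THREE extra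
data (action ceiling, a=1 energy envelope, firing floor).  Two of the three are CONSEQUENCES of the others by landed theorems of
route WakeRatchet (crux ⟨22743⟩, LINE «threshold ray», all `--supports 22743` helpers in the tree):

* the FIRING FLOOR follows from blow-up + envelope (`MinimalViscousBlowup.ThresholdRay.everyShellFires`: a never-firing shell is a
  closed valve trapping the shells above geometrically, contradicting blow-up);
* the ACTION CEILING follows from envelope + the FIRED FRONT CLOCK (FC′) (`…action_of_firedClock`), and **(FC′) follows from
  `TypeOne`** (`firedClock_of_typeOne` below: if shell `m` has fired, `λ^m‖X_m(s)‖² ≥ c ν²`, the type-I clock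
  `Λ^m (t⋆−s)‖X_m(s)‖ ≤ C₁` leaves at most `C₁/(ν√c) · λ^{-2m}` of life — `Λ² = λ⁵`).

Hence `eternalLimitViscBdd_of_envelope`: **(ω4)'s conclusion holds, at every `ε₀ > 0`, for every type-I viscous blow-up
(`ViscousUpTo ∧ BlowsUpAt ∧ TypeOne`, the registered hypotheses VERBATIM) that carries an a=1 ENERGY ENVELOPE
`(1+ε₀)^n ‖X_n(t)‖² ≤ C` on `[0, t⋆)`.**  REPAIR CENSUS for ⟨20420⟩ along this line: (ω4) as registered = this theorem minus the
envelope; the one missing estimate is «type-I viscous blow-ups in the comparable class have an a=1 energy envelope» (the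
dissipation-scale analogue of type I; obtained BY SELECTION at the threshold viscosity in WakeRatchet's ⟨22743⟩).

HONEST LABEL: reduction/bookkeeping over landed theorems; MODEL lattice ODEs of Tao 2016 §4 only; (ω3), (ω4), ⟨20420⟩, ⟨22743⟩ and every
NS statement remain OPEN; nothing here bears on the summit.
-/

noncomputable section

-- the summit and its single sub-problem share the name (CONVENTIONS §1)
set_option linter.dupNamespace false

namespace Summit.NavierStokesRegularity.NavierStokesRegularity.Theorems.EternalRigidityViscBddOne.Birth

open Set Filter Topology MeasureTheory
open Literature.Analysis.FluidPDE Literature.Analysis.FluidPDE.TaoCascade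

/-- **The fired front clock (FC′) from the type-I clock.**  If `Λ^n (t⋆ − t)‖X_n(t)‖ ≤ C₁` on `[0,t⋆)` (all shells) and
shell `m` has FIRED at level `c ν²` by time `t` (`c ν² ≤ λ^m ‖X_m(s)‖²` for some `s ≤ t`), then `t⋆ − t ≤ K/λ^{2m}` with
`K = C₁/(ν √c)` (`λ = 1+ε₀`, `Λ² = λ⁵`): once a shell has fired, at most `K λ^{-2m}` of life remains.
[cite: Tao2016AveragedNS, §4 (4.1) and §5 (the transit clock of the cascade); route WakeRatchet LINE «threshold ray» (FC′)] -/
theorem firedClock_of_typeOne {ε₀ ν T C₁ c : ℝ} (hε₀ : 0 < ε₀) (hν : 0 < ν) (hc : 0 < c)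
    {X : Fin 4 → ℤ → ℝ → ℝ}
    (hclk : ∀ (n : ℤ) (t : ℝ), 0 ≤ t → t < T → bigLam ε₀ ^ n * (T - t) * ‖shellVec X n t‖ ≤ C₁) :
    ∀ (m : ℕ) (t : ℝ), 0 ≤ t → t < T →
      (∃ s, 0 ≤ s ∧ s ≤ t ∧ c * ν ^ 2 ≤ (1 + ε₀) ^ m * ‖shellVec X m s‖ ^ 2) →
      T - t ≤ C₁ / (ν * Real.sqrt c) / (1 + ε₀) ^ (2 * m) := by
  intro m t _ht0 htT ⟨s, hs0, hst, hfire⟩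
  have hl0 : (0 : ℝ) < 1 + ε₀ := by linarith
  have hsT : s < T := lt_of_le_of_lt hst htT
  set L : ℝ := 1 + ε₀ with hL
  set a : ℝ := T - s with ha
  set v : ℝ := ‖shellVec X (m : ℤ) s‖ with hv
  have ha0 : 0 ≤ a := by rw [ha]; linarith
  have hv0 : 0 ≤ v := norm_nonneg _
  have hLm : 0 < L ^ (2 * m) := pow_pos hl0 _
  have hsqc : Real.sqrt c ^ 2 = c := Real.sq_sqrt hc.le
  have hsc0 : 0 < Real.sqrt c := Real.sqrt_pos.2 hc
  set K : ℝ := C₁ / (ν * Real.sqrt c) with hK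
  -- the clock at shell m, time s, squared: L^{5m} a² v² ≤ C₁²
  have h1 : bigLam ε₀ ^ (m : ℤ) * a * v ≤ C₁ := hclk m s hs0 hsT
  have hΛm : bigLam ε₀ ^ (m : ℤ) = bigLam ε₀ ^ m := zpow_natCast _ _
  have hprod0 : 0 ≤ bigLam ε₀ ^ (m : ℤ) * a * v :=
    mul_nonneg (mul_nonneg (zpow_nonneg (bigLam_pos (by linarith)).le _) ha0) hv0
  have hC₁0 : 0 ≤ C₁ := hprod0.trans h1
  have h2 : (bigLam ε₀ ^ m * a * v) ^ 2 ≤ C₁ ^ 2 := by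
    rw [← hΛm]; exact pow_le_pow_left₀ hprod0 h1 2
  have h3 : L ^ (5 * m) * a ^ 2 * v ^ 2 ≤ C₁ ^ 2 := by
    have : (bigLam ε₀ ^ m * a * v) ^ 2 = (bigLam ε₀ ^ m) ^ 2 * a ^ 2 * v ^ 2 := by ring
    rw [this, bigLam_pow_sq hε₀.le] at h2
    exact h2
  -- combine with the firing: c ν² L^{4m} a² ≤ L^{5m} v² a² ≤ C₁²
  have h4 : c * ν ^ 2 * (L ^ (4 * m) * a ^ 2) ≤ C₁ ^ 2 := by
    have hw : 0 ≤ L ^ (4 * m) * a ^ 2 := by positivity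
    calc c * ν ^ 2 * (L ^ (4 * m) * a ^ 2) ≤ L ^ m * v ^ 2 * (L ^ (4 * m) * a ^ 2) :=
          mul_le_mul_of_nonneg_right hfire hw
      _ = L ^ (5 * m) * a ^ 2 * v ^ 2 := by
          rw [show 5 * m = m + 4 * m by ring, pow_add]; ring
      _ ≤ C₁ ^ 2 := h3
  -- hence (a L^{2m})² ≤ K²
  have hK0 : 0 ≤ K := by rw [hK]; positivity
  have h5 : (a * L ^ (2 * m)) ^ 2 ≤ K ^ 2 := by
    have hden : 0 < c * ν ^ 2 := by positivity
    have e1 : (a * L ^ (2 * m)) ^ 2 = L ^ (4 * m) * a ^ 2 := by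
      rw [show 4 * m = 2 * (2 * m) by ring, pow_mul]; ring
    have e2 : K ^ 2 = C₁ ^ 2 / (c * ν ^ 2) := by
      rw [hK, div_pow, mul_pow, hsqc]; ring
    rw [e1, e2, le_div_iff₀ hden]
    calc L ^ (4 * m) * a ^ 2 * (c * ν ^ 2) = c * ν ^ 2 * (L ^ (4 * m) * a ^ 2) := by ring
      _ ≤ C₁ ^ 2 := h4
  have h6 : a * L ^ (2 * m) ≤ K :=
    (pow_le_pow_iff_left₀ (mul_nonneg ha0 hLm.le) hK0 two_ne_zero).1 h5
  have h7 : a ≤ K / L ^ (2 * m) := by rw [le_div_iff₀ hLm]; exact h6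
  calc T - t ≤ a := by rw [ha]; linarith
    _ ≤ K / L ^ (2 * m) := h7

/-- **(ω4) reduced to the a=1 energy envelope.**  For every `ε₀ > 0`, every table of `InTableClass R` (`R ≥ 1`), every `ν > 0`:
a maximal regular solution of the exact `ν`-viscous lattice from a one-shell datum that BLOWS UP at `t⋆` and is TYPE I
(`ViscousUpTo ∧ BlowsUpAt ∧ TypeOne` — the registered hypotheses of `stub_eternalLimitViscBdd` VERBATIM) and carries an a=1 energy
envelope `(1+ε₀)^n ‖X_n(t)‖² ≤ C` on `[0,t⋆)` has a uniformly bounded, forward-(S₁)-surviving admissible viscous eternal ω-limit.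
Firing floor: `everyShellFires`; (FC′): `firedClock_of_typeOne`; action: `action_of_firedClock`; extraction:
`eternalLimitViscBdd_of_ceilings` (all applied to the family with the negative shells zeroed at all times).
[cite: Tao2016AveragedNS, §4 Lemma 4.1 (4.5)–(4.11), Thm. 4.2, §5, §6.4; BarbatoMorandinRomito2011, §3.1; tree ⟨22744⟩ + WakeRatchet S4/S5 lemmas] -/
theorem eternalLimitViscBdd_of_envelope {R ε₀ ν : ℝ} (hR : 1 ≤ R) (hε₀ : 0 < ε₀) (hν : 0 < ν)
    {α : Fin 4 → Fin 4 → Fin 4 → ℤ × ℤ × ℤ → ℝ} {X₀ : Fin 4 → ℝ} (hα : InTableClass R α)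
    {X : Fin 4 → ℤ → ℝ → ℝ} {tStar : ℝ} (hV : ViscousUpTo ε₀ ν α X₀ X tStar) (hB : BlowsUpAt ε₀ X tStar)
    (hI : TypeOne ε₀ X tStar)
    (hE : ∃ C : ℝ, ∀ (n : ℤ) (t : ℝ), 0 ≤ t → t < tStar → (1 + ε₀) ^ n * ‖shellVec X n t‖ ^ 2 ≤ C) :
    ∃ (νh : ℝ) (W : ℤ → ℝ → Em 4), IsEternalVisc ε₀ νh α W ∧ UniformBound W ∧
      EternalSurvivingFwd 1 ε₀ W := by
  obtain ⟨C₃, hC₃⟩ := hE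
  have hT : 0 < tStar := hV.pos
  have hl0 : (0 : ℝ) < 1 + ε₀ := by linarith
  -- the family with the negative shells zeroed at ALL times
  set Z : Fin 4 → ℤ → ℝ → ℝ := fun i n t => if n < 0 then 0 else X i n t with hZ
  have hZX : ∀ (j : Fin 4) (k : ℤ) (t : ℝ), 0 ≤ t → t < tStar → Z j k t = X j k t := by
    intro j k t ht0 htT
    by_cases hk : k < 0
    · simp only [hZ, if_pos hk]; exact (hV.noLow j k t hk ht0 htT).symm
    · simp only [hZ, if_neg hk]
  have hZneg : ∀ (j : Fin 4) (k : ℤ) (t : ℝ), k < 0 → Z j k t = 0 := fun j k t hk => by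
    simp only [hZ, if_pos hk]
  have hZnn : ∀ (j : Fin 4) (k : ℤ), ¬ k < 0 → Z j k = X j k := fun j k hk => by
    funext t; simp only [hZ, if_neg hk]
  have hsv : ∀ (k : ℤ) (t : ℝ), 0 ≤ t → t < tStar → shellVec Z k t = shellVec X k t := by
    intro k t ht0 htT
    ext j
    rw [shellVec_apply, shellVec_apply, hZX j k t ht0 htT]
  -- the trajectory clauses for Z
  have hcdZ : ∀ i n, ContDiffOn ℝ 1 (Z i n) (Ico 0 tStar) := by
    intro i n
    by_cases hn : n < 0
    · have : Z i n = fun _ => 0 := funext fun t => hZneg i n t hn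
      rw [this]; exact contDiffOn_const
    · rw [hZnn i n hn]; exact hV.contDiffOn i n
  have hinitZ : ∀ i n, Z i n 0 = if n = 0 then X₀ i else 0 := by
    intro i n
    by_cases hn : n < 0
    · rw [hZneg i n 0 hn, if_neg (by omega)]
    · rw [hZnn i n hn]; exact hV.init i n
  have hlowZ : ∀ i n t, n < 0 → Z i n t = 0 := fun i n t hn => hZneg i n t hn
  have hmotZ : ∀ i n t, 0 ≤ t → t < tStar → derivWithin (Z i n) (Ici 0) t =
      quadTerm ε₀ α Z i n t - ν * (1 + ε₀) ^ ((2 : ℝ) * n) * Z i n t := by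
    intro i n t ht0 htT
    have hq : quadTerm ε₀ α Z i n t = quadTerm ε₀ α X i n t :=
      MinimalViscousBlowup.ThresholdRay.quadTerm_congr_at (fun j k => hZX j k t ht0 htT) i n
    by_cases hn : n < 0
    · have hz : Z i n = fun _ => 0 := funext fun s => hZneg i n s hn
      have hev : (X i n) =ᶠ[𝓝[Ici 0] t] (fun _ => (0 : ℝ)) := by
        have hmem : Ici 0 ∩ Iio tStar ∈ 𝓝[Ici 0] t := inter_mem_nhdsWithin (Ici 0) (Iio_mem_nhds htT)
        filter_upwards [hmem] with s hs using hV.noLow i n s hn hs.1 hs.2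
      have hdX : derivWithin (X i n) (Ici 0) t = derivWithin (fun _ => (0 : ℝ)) (Ici 0) t :=
        hev.derivWithin_eq (hV.noLow i n t hn ht0 htT)
      have hZ0 : Z i n t = 0 := hZneg i n t hn
      have hX0 : X i n t = 0 := hV.noLow i n t hn ht0 htT
      have hd : derivWithin (Z i n) (Ici 0) t = derivWithin (X i n) (Ici 0) t := by rw [hz, ← hdX]
      rw [hd, hV.motion i n t ht0 htT, hq, hZ0, hX0]
    · rw [hZnn i n hn, hq]
      exact hV.motion i n t ht0 htT
  have hregZ : ∀ T' : ℝ, 0 < T' → T' < tStar → ∃ M : ℝ, ∀ t : ℝ, 0 ≤ t → t ≤ T' →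
      ∀ (i : Fin 4) (n : ℤ), (1 + (1 + ε₀) ^ ((10 : ℝ) * n)) * |Z i n t| ≤ M := by
    intro T' hT' hT'T
    obtain ⟨M, hM⟩ := hV.apriori T' hT' hT'T
    exact ⟨M, fun t ht0 htT' i n => by
      rw [hZX i n t ht0 (lt_of_le_of_lt htT' hT'T)]; exact hM t ⟨ht0, htT'⟩ i n⟩
  have hblowZ : ∀ M : ℝ, ∃ t : ℝ, 0 ≤ t ∧ t < tStar ∧
      ∃ (i : Fin 4) (n : ℤ), M < (1 + (1 + ε₀) ^ ((10 : ℝ) * n)) * |Z i n t| := by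
    intro M
    obtain ⟨t, ht0, htT, i, n, hlt⟩ := hB M
    exact ⟨t, ht0, htT, i, n, by rw [hZX i n t ht0 htT]; exact hlt⟩
  have henvZ : ∀ (n : ℤ) (t : ℝ), 0 ≤ t → t < tStar → (1 + ε₀) ^ n * ‖shellVec Z n t‖ ^ 2 ≤ C₃ := by
    intro n t ht0 htT
    rw [hsv n t ht0 htT]; exact hC₃ n t ht0 htT
  -- the firing floor (WakeRatchet S4)
  obtain ⟨c₀, hc₀, hfires⟩ := MinimalViscousBlowup.ThresholdRay.everyShellFires ε₀ hε₀ R hR α hα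
  have hfloorZ := hfires X₀ ν tStar C₃ Z hν hT hcdZ hinitZ hlowZ hmotZ hregZ hblowZ henvZ
  -- the type-I clock for Z and the fired front clock (FC′)
  obtain ⟨C₁, hC₁⟩ := clock_of_typeOne hε₀ hI
  have hclkZ : ∀ (n : ℤ) (t : ℝ), 0 ≤ t → t < tStar →
      bigLam ε₀ ^ n * (tStar - t) * ‖shellVec Z n t‖ ≤ C₁ := by
    intro n t ht0 htT
    rw [hsv n t ht0 htT]; exact hC₁ n t ht0 htT
  set cfc : ℝ := 1 / (32768 * (1 + ε₀) ^ 16) with hcfc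
  have hcfc0 : 0 < cfc := by rw [hcfc]; positivity
  have hFC := firedClock_of_typeOne (c := cfc) hε₀ hν hcfc0 hclkZ
  set K : ℝ := C₁ / (ν * Real.sqrt cfc) with hK
  have hC₁0 : 0 ≤ C₁ := by
    have h := hC₁ 0 0 le_rfl hT
    have : 0 ≤ bigLam ε₀ ^ (0 : ℤ) * (tStar - 0) * ‖shellVec X 0 0‖ :=
      mul_nonneg (mul_nonneg (zpow_nonneg (bigLam_pos (by linarith)).le _) (by linarith)) (norm_nonneg _)
    exact this.trans h
  have hK0 : 0 ≤ K := by rw [hK]; positivity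
  -- the action ceiling (WakeRatchet S5, action clause from (FC′))
  have hα1 : ∀ i₁ i₂ i₃, |α i₁ i₂ i₃ (0, 0, 1)| ≤ 1 := fun i₁ i₂ i₃ =>
    (hα.2.2 i₁ i₂ i₃ (0, 0, 1) (by simp [mem_shiftSet_iff])).1
  have hactZ := MinimalViscousBlowup.ThresholdRay.action_of_firedClock hε₀ hν hT hK0 hα.2.1 hα1
    hcdZ hinitZ hlowZ hmotZ hregZ henvZ hFC
  -- the skeleton's structures for Z
  have hVZ : ViscousUpTo ε₀ ν α X₀ Z tStar :=
    { pos := hT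
      contDiffOn := hcdZ
      apriori := fun T' hT' hT'T => by
        obtain ⟨M, hM⟩ := hregZ T' hT' hT'T
        exact ⟨M, fun t ht i n => hM t ht.1 ht.2 i n⟩
      init := hinitZ
      motion := hmotZ
      noLow := fun i n t hn _ _ => hZneg i n t hn }
  have hIZ : TypeOne ε₀ Z tStar := by
    obtain ⟨C, hC⟩ := hI
    exact ⟨C, fun t ht0 htT i n => by rw [hZX i n t ht0 htT]; exact hC t ht0 htT i n⟩
  exact eternalLimitViscBdd_of_ceilings hε₀ hν hα hVZ hIZ ⟨_, hactZ⟩ ⟨C₃, henvZ⟩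
    ⟨c₀ * ν ^ 2, by positivity, hfloorZ⟩

end Summit.NavierStokesRegularity.NavierStokesRegularity.Theorems.EternalRigidityViscBddOne.Birth

end
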